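import Summits.BirchSwinnertonDyer.BirchSwinnertonDyer.Theorems.ByReductionTypeAtTwoP412KernelRealPlace
import Summits.BirchSwinnertonDyer.BirchSwinnertonDyer.Theorems.SmallImageMuTransferMuTransferX9TorsionUnramifiedOutside
import Summits.BirchSwinnertonDyer.BirchSwinnertonDyer.Theorems.AdditiveKolyvaginRoadLevelDefs
import Literature.NumberTheory.GaloisCohomology.TateGlobalEulerCharacteristicTwin
import Literature.NumberTheory.GaloisCohomology.RestrictedRamificationDegreeOne
import Literature.NumberTheory.EllipticCurves.SelmerTorsionTwistRestriction
import Literature.NumberTheory.EllipticCurves.QuadraticTwist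
import Literature.NumberTheory.EllipticCurves.Rank1Residual.Predicates
import HarnessLib

/-!
# (Eig±) for line `admdef` of crux `AnticyclotomicEisensteinDivisibility` (SBC, stmt-BirchSwinnertonDyer-20727):
# both eigenspaces of complex conjugation on `H¹(K, E[p])` are non-zero — FROM Tate's global Euler–Poincaré
# characteristic over `ℚ` (the typed named fact `tateGlobalEulerPoincareCharacteristic ℚ`)

Route `SignedBaseChange` (SBC), crux `AnticyclotomicEisensteinDivisibility`, line `admdef` (skeleton v9
`Cruxes/AnticyclotomicEisensteinDivisibility/Lines/admdef.lean`, sha16 31593703cccf6096, LEAD `bsd-line-sbc-p1`), registered PRINT stub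
`stub_eigenSupply : Signdetour.EigenSupplyNS` ((Eig±), «PRINT, small: Tate EPC over ℚ + inflation–restriction — hands»; desk
`bsd-inputs` INPUTS-LIST-2 ADD-102 entry C78, «prove now ≤ M»). Resident INPUTS prover `bsd-inputs-honda-p1` g16; a
`--supports 20727 --as helper` file. THEOREMS ONLY (no definition, no named fact, no instance, no `sorry`). HONEST FRAMING:
everything here is CONDITIONAL on the displayed hypothesis `hT : tateGlobalEulerPoincareCharacteristic ℚ` (Milne, *ADT* I Thm. 5.1
over `ℚ` — the tree proves the formula only at totally complex fields, `tateGlobalEulerPoincareCharacteristic_of_isTotallyComplex`);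
nothing is asserted about it; the crux, its research stub `stub_definiteAnchorSigned` and BSD are NOT proved by any of this.

* `exists_ne_zero_galH1Torsion_rat` — **`H¹(ℚ, E[p]) ≠ 0`** for every elliptic `W/ℚ` and every odd prime `p`, GIVEN `hT`:
  with `ρ = W.torsionGaloisModule p` (`E[p]` as a discrete `Γ_ℚ`-module), `S = bad places ∪ {p}` (`E[p]` unramified outside `S`,
  `Rank1Residual.TorsionUnramified.isUnramifiedOutside_torsionGaloisModule`), Tate's formula at `(S, E[p])` reads
  `#H⁰(G_S, E[p])·#H²(G_S, E[p])·p² = #H¹(G_S, E[p])·#E[p]^{Γ_ℝ}`, and `#E[p]^{Γ_ℝ} ≤ 2p < p²` (Weil pairing, the tree's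
  `P412Kernel.natCard_fixedBy_le_two_mul`); so `H¹(G_{ℚ,S}, E[p]) = 0` is impossible (an infinite `H⁰`/`H²` would force
  `#E[p]^{Γ_ℝ} = 0`), and a non-zero class inflates injectively into `H¹(ℚ, E[p])` (`restrictedInf_one_injective`). No finiteness
  fact (`finite_restrictedCohomology`) is used.
* `exists_eigenclass_of_tate` — for a quadratic number field `K` with non-trivial automorphism `σ` and an odd prime `p`: for each
  sign `s` a NON-ZERO class `y ∈ H¹(K, E[p])` with `σ·y = sgnP s · y` — `+`: `res x` (`conjAct_resTorsion`,
  `resTorsion_injective_of_odd`); `−`: `hPsiKT (res x′)` for `x′ ∈ H¹(ℚ, E^{(c)}[p])`, `K = ℚ(θ)`, `θ² = c`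
  (`conjAct_hPsiKT`) — Gross 1991 (5.1), both halves fed by `exists_ne_zero_galH1Torsion_rat` (for `E` and for its twist `E^{(c)}`).
* `exists_eigenclass_of_tate_of_eq` — the same at any level `n = p` (transport to the AKR level `((p ^ 1 : ℕ) : ℤ)` of `AdditiveKoly.Vp`).
* `eigenSupplyNS_of_tate` — **the registered text of `Signdetour.EigenSupplyNS` (with `Signdetour.EigenSupplyAt` UNFOLDED; both are
  skeleton-local `def`s, not importable under `Theorems/`)**, under the one hypothesis `hT`: for `p ≥ 5`, `W/ℚ` globally minimal,
  `Surj W p`, `K` imaginary quadratic, `c ≠ 1`, every `ZMod p`-structure on `Vp W K p`, and each sign `s`: a non-zero `x ∈ Vp W K p`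
  with `conjAct W c (p ^ 1) x = sgnP s • x`. SPLICE for the LEAD: `theorem stub_eigenSupply : Signdetour.EigenSupplyNS :=
  …SignedBaseChangeAcDivAdmdefEigenSupply.eigenSupplyNS_of_tate hT` (`EigenSupplyAt` unfolds by `def`), with
  `hT : tateGlobalEulerPoincareCharacteristic ℚ` taken as a displayed PRINT input of the line (e.g. a conjunct of `stub_namedFactsSS`).

References: J. S. Milne, *Arithmetic Duality Theorems* (2006), I Thm. 5.1 with footnote 13, Cor. 4.15; J. Neukirch, A. Schmidt,
K. Wingberg, *Cohomology of Number Fields* (2008), (8.7.4), (1.6.7); B. H. Gross, *Kolyvagin's work on modular elliptic curves*,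
LMS LNS 153 (1991), §5 (5.1); J. H. Silverman, *AEC*, III.6.4, III.8.1, VII.4.1.
-/

set_option autoImplicit false
-- the Theorems namespace of this sub repeats the summit name by design (D-0017 nested layout)
set_option linter.dupNamespace false

noncomputable section

open scoped Classical NumberField

namespace Summit.BirchSwinnertonDyer.BirchSwinnertonDyer.Theorems.SignedBaseChangeAcDivAdmdefEigenSupply

open Function Field NumberField IsDedekindDomain WeierstrassCurve
  Literature.NumberTheory.EllipticCurves Literature.NumberTheory.EllipticCurves.Rank1Residual
  Literature.NumberTheory.GaloisRepresentations Literature.NumberTheory.GaloisRepresentations.DiscreteGaloisModule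
  Literature.NumberTheory.GaloisCohomology Literature.NumberTheory.QuadraticFields
  Summit.BirchSwinnertonDyer.BirchSwinnertonDyer.Theorems.AdditiveKoly
  Summit.BirchSwinnertonDyer.BirchSwinnertonDyer.Theorems.P412Kernel
  Summit.BirchSwinnertonDyer.BirchSwinnertonDyer.Rank1Residual.TorsionUnramified

/-! ## §1 `H¹(ℚ, E[p]) ≠ 0` from Tate's formula over `ℚ` -/

/-- **`H¹(ℚ, E[p]) ≠ 0`** for an elliptic curve `E = W/ℚ` and an odd prime `p`, GIVEN Tate's global Euler–Poincaré characteristic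
formula over `ℚ` (`hT`). With `S` = bad places `∪ {p}`, Tate at the finite `G_{ℚ,S}`-module `E[p]` (`#E[p] = p²`, one real place):
`#H⁰·#H²·p² = #H¹(G_{ℚ,S}, E[p]) · #E[p]^{Γ_ℝ}` and `1 ≤ #E[p]^{Γ_ℝ} ≤ 2p < p²` (the Weil pairing makes complex conjugation invert
`μ_p`, so it cannot fix `E[p]`); hence `H¹(G_{ℚ,S}, E[p])` is not the zero group, and its classes inflate injectively into `H¹(ℚ, E[p])`.
[cite: MilneADT2006, Ch. I, Thm. 5.1 with footnote 13 (p. 67)] [cite: NeukirchSchmidtWingberg2008, (8.7.4) and (1.6.7)]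
[cite: SilvermanAEC2009, Cor. III.6.4(b), Prop. III.8.1, Prop. VII.4.1(a)] -/
theorem exists_ne_zero_galH1Torsion_rat (hT : tateGlobalEulerPoincareCharacteristic ℚ)
    (W : WeierstrassCurve ℚ) [W.IsElliptic] {p : ℕ} (hp : p.Prime) (hp2 : p ≠ 2) :
    ∃ x : galH1Torsion W (p : ℤ), x ≠ 0 := by
  haveI : NeZero p := ⟨hp.ne_zero⟩
  haveI : Finite (geomTorsion W (p : ℤ)) := finite_geomTorsion_of_neZero W p
  set ρ : DiscreteGaloisModule ℚ (geomTorsion W (p : ℤ)) := W.torsionGaloisModule (p : ℤ) with hρ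
  set S : Set (HeightOneSpectrum (𝓞 ℚ)) := W.badPlaces (𝓞 ℚ) ∪ {v | ((p : ℕ) : 𝓞 ℚ) ∈ v.asIdeal}
    with hS
  have hSfin : S.Finite :=
    (W.finite_badPlaces_holds (𝓞 ℚ)).union (HeightOneSpectrum.finite_setOf_natCast_mem hp.ne_zero)
  have hur : GaloisRep.IsUnramifiedOutside S ρ := isUnramifiedOutside_torsionGaloisModule W p
  have hcardM : Nat.card (geomTorsion W (p : ℤ)) = p ^ 2 :=
    card_torsionPoints_eq_sq_holds W (AlgebraicClosure ℚ) (by exact_mod_cast hp.ne_zero)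
  have hcard : ∀ v : HeightOneSpectrum (𝓞 ℚ),
      ((Nat.card (geomTorsion W (p : ℤ)) : ℕ) : 𝓞 ℚ) ∈ v.asIdeal → v ∈ S := by
    intro v hv
    rw [hcardM, Nat.cast_pow] at hv
    exact Or.inr (v.isPrime.mem_of_pow_mem 2 hv)
  -- Tate's formula at `(S, E[p])`, one real place of multiplicity one
  have hE := hT S hSfin (geomTorsion W (p : ℤ)) ρ hur hcard
  rw [Fintype.prod_unique, Fintype.prod_unique, hcardM] at hE
  have hdef : (default : InfinitePlace ℚ) = Rat.infinitePlace := rfl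
  have hmult : (default : InfinitePlace ℚ).mult = 1 := by
    rw [hdef]; exact InfinitePlace.mult_isReal ⟨Rat.infinitePlace, Rat.isReal_infinitePlace⟩
  rw [hmult, pow_one, hdef] at hE
  -- the real place: `1 ≤ #E[p]^{Γ_ℝ} ≤ 2p`
  have hreal : Nat.card (galoisCohomology (ρ.toLocal (Sum.inl Rat.infinitePlace)) 0) ≤ 2 * p := by
    rw [natCard_galoisCohomology_zero_toLocal_inl_eq_natCard_invariants]
    obtain ⟨σ₁, hσ₁⟩ : ∃ c : absoluteGaloisGroup (Rat.infinitePlace.Completion), c ≠ 1 :=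
      exists_ne_one_absoluteGaloisGroup_of_isReal Rat.isReal_infinitePlace
    refine le_trans (Nat.card_le_card_of_injective
      (fun m : (ρ.toLocal (Sum.inl Rat.infinitePlace)).invariants ↦
        (⟨m.1, (ContinuousRep.mem_invariants _ _).mp m.2 σ₁⟩ : {T : W.geomTorsion (p : ℤ) //
          absGaloisRestrict ℚ Rat.infinitePlace.Completion σ₁ • T = T})) ?_)
      (natCard_fixedBy_le_two_mul W Rat.infinitePlace hσ₁ hp.two_le)
    intro m m' h
    apply Subtype.ext
    simpa using congrArg (fun t => (Subtype.val t : W.geomTorsion (p : ℤ))) h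
  have hreal_pos : 0 < Nat.card (galoisCohomology (ρ.toLocal (Sum.inl Rat.infinitePlace)) 0) := by
    rw [natCard_galoisCohomology_zero_toLocal_inl_eq_natCard_invariants]
    exact Nat.card_pos
  -- if `H¹(ℚ, E[p]) = 0` then `H¹(G_{ℚ,S}, E[p]) = 0` (inflation is injective) and Tate's formula is violated
  by_contra hzero
  simp only [ne_eq, not_exists, not_not] at hzero
  have hsub : ∀ y : restrictedCohomology ρ S 1, y = 0 := fun y ↦
    restrictedInf_one_injective ρ S (by rw [map_zero]; exact hzero _)
  have h1 : Nat.card (restrictedCohomology ρ S 1) = 1 := by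
    rw [Nat.card_eq_one_iff_unique]
    exact ⟨⟨fun a b ↦ by rw [hsub a, hsub b]⟩, ⟨0⟩⟩
  rw [h1, one_mul] at hE
  have hpos : 0 < Nat.card (restrictedCohomology ρ S 0) * Nat.card (restrictedCohomology ρ S 2) := by
    rcases Nat.eq_zero_or_pos (Nat.card (restrictedCohomology ρ S 0) * Nat.card (restrictedCohomology ρ S 2))
      with h0 | h0
    · rw [h0, zero_mul] at hE; omega
    · exact h0
  have hle : p ^ 2 ≤ 2 * p := le_trans (le_trans (Nat.le_mul_of_pos_left _ hpos) (le_of_eq hE)) hreal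
  have hp3 : 3 ≤ p := by have := hp.two_le; omega
  nlinarith

/-! ## §2 Both eigenspaces of `Gal(K/ℚ)` on `H¹(K, E[p])` are non-zero (Gross 1991 (5.1), fed by §1) -/

/-- **For each sign a NON-ZERO eigenclass of complex conjugation on `H¹(K, E[p])`** (`K` a quadratic number field, `σ ≠ 1` in
`Aut(K/ℚ)`, `p` an odd prime), GIVEN Tate's formula over `ℚ`: sign `+1` — the restriction `res x` of a non-zero `x ∈ H¹(ℚ, E[p])`
(§1) is non-zero (`resTorsion_injective_of_odd`) and `σ`-fixed (`conjAct_resTorsion`); sign `−1` — write `K = ℚ(θ)`, `θ² = c`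
(`Quadratic.exists_sq_eq_algebraMap`, `σ = sigmaQ`): for a non-zero `x′ ∈ H¹(ℚ, E^{(c)}[p])` (§1 for the elliptic twist `E^{(c)}`),
`hPsiKT (res x′) ∈ H¹(K, E[p])` is non-zero and `σ` acts on it by `−1` (`conjAct_hPsiKT`).
[cite: GrossLMS1991, §5 (5.1)] [cite: MilneADT2006, Ch. I, Thm. 5.1] -/
theorem exists_eigenclass_of_tate (hT : tateGlobalEulerPoincareCharacteristic ℚ)
    (W : WeierstrassCurve ℚ) [W.IsElliptic] (K : Type) [Field K] [NumberField K]
    (h2 : Module.finrank ℚ K = 2) (σ : K ≃ₐ[ℚ] K) (hσ : σ ≠ 1) {p : ℕ} (hp : p.Prime) (hp2 : p ≠ 2)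
    (s : Bool) :
    ∃ y : galH1Torsion (W.baseChange K) (p : ℤ), y ≠ 0 ∧ conjAct W σ (p : ℤ) y = sgnP s • y := by
  haveI : IsGalois ℚ K := isGalois_of_finrank_eq_two K h2
  cases s with
  | true =>
    obtain ⟨x, hx⟩ := exists_ne_zero_galH1Torsion_rat hT W hp hp2
    refine ⟨resTorsion W K (p : ℤ) x, ?_, ?_⟩
    · exact fun h ↦ hx (resTorsion_injective_of_odd K W σ h2 hσ hp hp2 (by rw [h, map_zero]))
    · rw [conjAct_resTorsion K W (p : ℤ) σ h2 hσ x]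
      simp [sgnP]
  | false =>
    obtain ⟨θ, c, hθ, hc⟩ := Quadratic.exists_sq_eq_algebraMap (F := ℚ) (K := K) h2
    have hc0 : c ≠ 0 := by
      rintro rfl
      rw [map_zero] at hc
      exact hθ ⟨0, by rw [map_zero]; exact ((pow_eq_zero_iff two_ne_zero).mp hc).symm⟩
    haveI : (W.quadraticTwist c).IsElliptic := W.isElliptic_quadraticTwist hc0
    have hσ' : σ = sigmaQ K h2 hθ hc := eq_sigmaQ_of_ne_one K h2 σ hσ hθ hc
    subst hσ'
    obtain ⟨x, hx⟩ := exists_ne_zero_galH1Torsion_rat hT (W.quadraticTwist c) hp hp2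
    refine ⟨hPsiKT W K hθ hc (p : ℤ) (resTorsion (W.quadraticTwist c) K (p : ℤ) x), ?_, ?_⟩
    · intro h
      apply hx
      apply resTorsion_injective_of_odd K (W.quadraticTwist c) (sigmaQ K h2 hθ hc) h2 (sigmaQ_ne_one K h2 hθ hc) hp hp2
      rw [map_zero]
      exact (hPsiKT W K hθ hc (p : ℤ)).injective (by rw [h, map_zero])
    · rw [conjAct_hPsiKT W K h2 hθ hc (p : ℤ),
        conjAct_resTorsion K (W.quadraticTwist c) (p : ℤ) _ h2 (sigmaQ_ne_one K h2 hθ hc)]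
      simp [sgnP]

/-- The same at any torsion level `n` EQUAL to `p` (transport to the AKR spelling `((p ^ 1 : ℕ) : ℤ)` of `AdditiveKoly.Vp`).
[cite: GrossLMS1991, §5 (5.1)] -/
theorem exists_eigenclass_of_tate_of_eq (hT : tateGlobalEulerPoincareCharacteristic ℚ)
    (W : WeierstrassCurve ℚ) [W.IsElliptic] (K : Type) [Field K] [NumberField K]
    (h2 : Module.finrank ℚ K = 2) (σ : K ≃ₐ[ℚ] K) (hσ : σ ≠ 1) {p : ℕ} (hp : p.Prime) (hp2 : p ≠ 2)
    {n : ℤ} (hn : n = (p : ℤ)) (s : Bool) :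
    ∃ y : galH1Torsion (W.baseChange K) n, y ≠ 0 ∧ conjAct W σ n y = sgnP s • y := by
  subst hn
  exact exists_eigenclass_of_tate hT W K h2 σ hσ hp hp2 s

/-! ## §3 The registered text of `Signdetour.EigenSupplyNS`, unfolded, from `hT` -/

/-- **(Eig±) `Signdetour.EigenSupplyNS` of line `admdef` v9 (crux `AnticyclotomicEisensteinDivisibility`, stmt-BirchSwinnertonDyer-20727)
— its text with `Signdetour.EigenSupplyAt` UNFOLDED — from Tate's global Euler–Poincaré characteristic over `ℚ`**: for every prime
`p ≥ 5`, globally minimal elliptic `W/ℚ` with `ρ̄_{E,p}` onto, imaginary quadratic `K`, `c ≠ 1` in `Aut(K/ℚ)`, any `ZMod p`-structure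
on `Vp W K p = H¹(K, E[p])`, and each sign `s`: a NON-ZERO `x ∈ Vp W K p` with `c·x = sgnP s · x`. (`Surj`, global minimality,
`5 ≤ p` beyond `p` odd and the `ZMod p`-structure are carried, unused.) The LEAD splices
`stub_eigenSupply := eigenSupplyNS_of_tate hT` with `hT` a displayed print input. CONDITIONAL on `hT`; nothing else asserted.
[cite: MilneADT2006, Ch. I, Thm. 5.1, Cor. 4.15] [cite: NeukirchSchmidtWingberg2008, (8.7.4)] [cite: GrossLMS1991, §5 (5.1)] -/
theorem eigenSupplyNS_of_tate (hT : tateGlobalEulerPoincareCharacteristic ℚ) :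
    ∀ {p : ℕ} [Fact p.Prime] (W : WeierstrassCurve ℚ) [W.IsElliptic] [W.IsGloballyMinimal]
      (K : Type) [Field K] [NumberField K],
      5 ≤ p → Surj W p → IsImaginaryQuadratic K →
      ∀ (c : K ≃ₐ[ℚ] K), c ≠ 1 → ∀ [Module (ZMod p) (AdditiveKoly.Vp W K p)],
        ∀ s : Bool, ∃ x : AdditiveKoly.Vp W K p, x ≠ 0 ∧ conjAct W c ((p ^ 1 : ℕ) : ℤ) x = AdditiveKoly.sgnP s • x := by
  intro p _ W _ _ K _ _ h5 _ hK c hc1 _ s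
  have hp : p.Prime := Fact.out
  exact exists_eigenclass_of_tate_of_eq hT W K hK.1 c hc1 hp (by omega) (by rw [pow_one]) s

end Summit.BirchSwinnertonDyer.BirchSwinnertonDyer.Theorems.SignedBaseChangeAcDivAdmdefEigenSupply

end
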